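import Mathlib
import Literature.NumberTheory.LFunctions.MertensElementary
import HarnessLib

/-!
# Route `IntegerScrew` — Euler products over ranges of primes and the fibres of `minFac`
# (the prime-sum inputs of PROPOSITIONS K and K″, CONTINUUM-LIMIT §25.9, §27)

Elementary harmonic-mass bounds used by the root flow of PROP. K (`IntegerScrewPropK`) and by the hub flow of
PROP. K″ (CONTINUUM-LIMIT §27.2, the `α`/`γ` loads live on the fibres of `minFac` above `Q`):

* `sum_inv_factored_le_prod` — `Σ_{m ≤ X, m ∈ factoredNumbers s} 1/m ≤ Π_{p ∈ s prime}(1 − 1/p)⁻¹` (Mathlib's Euler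
  product);
* `prod_primesBelow_succ_inv_le` — `Π_{q ≤ N}(1 − 1/q)⁻¹ ≤ e⁵·log N` (`N ≥ 2`; the tree's crude Mertens product
  `MertensBound.exp_neg_div_log_le_prod_one_sub_inv`);
* `log_le_prod_primesBelow_inv` — `log q ≤ Π_{ℓ<q}(1 − 1/ℓ)⁻¹`;
* **`prod_range_inv_le`** — `Π_{q ≤ ℓ ≤ X prime}(1 − 1/ℓ)⁻¹ ≤ 1 + e⁵·log(X+1)/log q` (`q ≥ 2`);
* **`sum_minFac_fibre_le`** — `Σ_{2 ≤ y ≤ R, minFac y = q} 1/y ≤ (1/q)·(1 + e⁵·log(R/q + 1)/log q)` (`q` prime).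

RH-free, elementary (constants crude: `e⁵` for `e^γ`).  Nothing in this file bears on the truth of RH.
References: CONTINUUM-LIMIT §25.9, §27 (rh-explicit A6-PIVOT); M. Suzuki, J. Lond. Math. Soc. (2) 108 (2023)
1448–1487 [Suzuki2023] for the screw matrices this serves.
-/

noncomputable section

set_option linter.dupNamespace false -- D-0017: `Summit.<S>.<S>.…` is the designed namespace

namespace Summit.RiemannHypothesis.RiemannHypothesis.Theorems.IntegerScrew

open Finset Real

/-! ### Harmonic mass of the numbers with prime factors in a range -/

/-- **Euler product over a range**: `Σ_{m ≤ X, m ∈ factoredNumbers s} 1/m ≤ Π_{p ∈ s prime}(1 − 1/p)⁻¹`. -/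
theorem sum_inv_factored_le_prod (s : Finset ℕ) (X : ℕ) :
    ∑ m ∈ (Icc 1 X).filter (· ∈ Nat.factoredNumbers s), (1 : ℝ) / m ≤
      ∏ p ∈ s with p.Prime, (1 - 1 / (p : ℝ))⁻¹ := by
  let f : ℕ →* ℝ :=
    { toFun := fun n => (n : ℝ)⁻¹
      map_one' := by simp
      map_mul' := fun m n => by push_cast; rw [mul_inv] }
  have hf : ∀ n : ℕ, f n = (n : ℝ)⁻¹ := fun _ => rfl
  have hlt : ∀ {p : ℕ}, p.Prime → ‖f p‖ < 1 := by
    intro p hp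
    rw [hf, Real.norm_eq_abs, abs_of_nonneg (by positivity)]
    exact inv_lt_one_of_one_lt₀ (by exact_mod_cast hp.one_lt)
  obtain ⟨-, hsum⟩ := EulerProduct.summable_and_hasSum_factoredNumbers_prod_filter_prime_geometric hlt s
  have hind : HasSum ((Nat.factoredNumbers s).indicator (fun n : ℕ => (f n : ℝ)))
      (∏ p ∈ s with p.Prime, (1 - f p)⁻¹) := hasSum_subtype_iff_indicator.1 hsum
  have hnn : ∀ n, 0 ≤ (Nat.factoredNumbers s).indicator (fun n : ℕ => (f n : ℝ)) n := by
    intro n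
    by_cases hn : n ∈ Nat.factoredNumbers s
    · rw [Set.indicator_of_mem hn, hf]; positivity
    · rw [Set.indicator_of_notMem hn]
  have hle := sum_le_hasSum (Icc 1 X) (fun n _ => hnn n) hind
  have hlhs : ∑ m ∈ (Icc 1 X).filter (· ∈ Nat.factoredNumbers s), (1 : ℝ) / m =
      ∑ n ∈ Icc 1 X, (Nat.factoredNumbers s).indicator (fun n : ℕ => (f n : ℝ)) n := by
    rw [Finset.sum_filter]
    refine Finset.sum_congr rfl fun n _ => ?_
    by_cases hn : n ∈ Nat.factoredNumbers s
    · rw [if_pos hn, Set.indicator_of_mem hn, hf, one_div]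
    · rw [if_neg hn, Set.indicator_of_notMem hn]
  have hrhs : ∏ p ∈ s with p.Prime, (1 - f p)⁻¹ = ∏ p ∈ s with p.Prime, (1 - 1 / (p : ℝ))⁻¹ :=
    Finset.prod_congr rfl fun p _ => by rw [hf, one_div]
  rw [hlhs, ← hrhs]
  exact hle

/-- The crude Mertens product for every `N ≥ 2`: `Π_{q ≤ N}(1 − 1/q)⁻¹ ≤ e⁵·log N`
(`Literature…MertensBound.exp_neg_div_log_le_prod_one_sub_inv`). -/
theorem prod_primesBelow_succ_inv_le {N : ℕ} (hN : 2 ≤ N) :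
    ∏ q ∈ (N + 1).primesBelow, (1 - 1 / (q : ℝ))⁻¹ ≤ Real.exp 5 * Real.log N := by
  have hlog : 0 < Real.log N := Real.log_pos (by exact_mod_cast (show 1 < N by omega))
  have h : Real.exp (-5) / Real.log N ≤ ∏ q ∈ (N + 1).primesBelow, (1 - 1 / (q : ℝ)) :=
    Literature.NumberTheory.LFunctions.MertensBound.exp_neg_div_log_le_prod_one_sub_inv N hN
  have hpos : 0 < ∏ q ∈ (N + 1).primesBelow, (1 - 1 / (q : ℝ)) := by
    refine Finset.prod_pos fun q hq => ?_
    have hq1 : (1 : ℝ) < q := by exact_mod_cast (Nat.mem_primesBelow.1 hq).2.one_lt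
    rw [sub_pos, div_lt_one (by linarith)]; exact hq1
  rw [Finset.prod_inv_distrib]
  calc (∏ q ∈ (N + 1).primesBelow, (1 - 1 / (q : ℝ)))⁻¹ ≤ (Real.exp (-5) / Real.log N)⁻¹ :=
        (inv_le_inv₀ hpos (div_pos (Real.exp_pos _) hlog)).2 h
    _ = Real.exp 5 * Real.log N := by rw [inv_div, Real.exp_neg, div_inv_eq_mul, mul_comm]

/-- `log q ≤ Π_{ℓ < q}(1 − 1/ℓ)⁻¹` for `q ≥ 1` (`H_{q−1} ≤` the Euler product over the numbers with all prime
factors `< q`). -/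
theorem log_le_prod_primesBelow_inv {q : ℕ} (hq : 1 ≤ q) :
    Real.log q ≤ ∏ ℓ ∈ q.primesBelow, (1 - 1 / (ℓ : ℝ))⁻¹ := by
  have h1 := sum_inv_factored_le_prod (Finset.range q) (q - 1)
  have hall : (Icc 1 (q - 1)).filter (· ∈ Nat.factoredNumbers (Finset.range q)) = Icc 1 (q - 1) := by
    refine Finset.filter_true_of_mem fun m hm => ?_
    have hm' := Finset.mem_Icc.1 hm
    refine Nat.mem_factoredNumbers.2 ⟨by omega, fun ℓ hℓ => Finset.mem_range.2 ?_⟩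
    have hℓ' := (Nat.mem_primeFactorsList (by omega)).1 hℓ
    have := Nat.le_of_dvd (by omega) hℓ'.2
    omega
  rw [hall] at h1
  have h2 : Real.log q ≤ ∑ m ∈ Icc 1 (q - 1), (1 : ℝ) / m := by
    have h := log_add_one_le_harmonic (q - 1)
    rw [harmonic_eq_sum_Icc, Rat.cast_sum] at h
    rw [Nat.sub_add_cancel hq] at h
    simpa [one_div] using h
  exact h2.trans h1

/-- **The Euler product over a range of primes**: for `2 ≤ q`,
`Π_{q ≤ ℓ ≤ X, ℓ prime}(1 − 1/ℓ)⁻¹ ≤ 1 + e⁵·log(X+1)/log q`. -/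
theorem prod_range_inv_le {q X : ℕ} (hq : 2 ≤ q) :
    ∏ ℓ ∈ (Icc q X).filter Nat.Prime, (1 - 1 / (ℓ : ℝ))⁻¹ ≤ 1 + Real.exp 5 * Real.log ((X : ℝ) + 1) / Real.log q := by
  have hlogq : 0 < Real.log q := Real.log_pos (by exact_mod_cast (show 1 < q by omega))
  have hX1 : 0 ≤ Real.log ((X : ℝ) + 1) := Real.log_nonneg (by have := Nat.cast_nonneg (α := ℝ) X; linarith)
  have hextra : 0 ≤ Real.exp 5 * Real.log ((X : ℝ) + 1) / Real.log q := by positivity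
  rcases lt_or_ge X q with hXq | hXq
  · -- empty range
    have : (Icc q X).filter Nat.Prime = ∅ := by
      rw [Finset.filter_eq_empty_iff]; intro ℓ hℓ; have := Finset.mem_Icc.1 hℓ; omega
    rw [this, Finset.prod_empty]; linarith
  · -- split the product below X+1 at q
    have hsplit : (X + 1).primesBelow = q.primesBelow ∪ (Icc q X).filter Nat.Prime := by
      ext ℓ
      simp only [Nat.mem_primesBelow, Finset.mem_union, Finset.mem_filter, Finset.mem_Icc]
      constructor
      · rintro ⟨h1, h2⟩
        by_cases hlq : ℓ < q
        · exact Or.inl ⟨hlq, h2⟩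
        · exact Or.inr ⟨⟨by omega, by omega⟩, h2⟩
      · rintro (⟨h1, h2⟩ | ⟨⟨h1, h2⟩, h3⟩)
        · exact ⟨by omega, h2⟩
        · exact ⟨by omega, h3⟩
    have hdisj : Disjoint q.primesBelow ((Icc q X).filter Nat.Prime) := by
      rw [Finset.disjoint_left]; intro ℓ h1 h2
      have := (Nat.mem_primesBelow.1 h1).1; have := (Finset.mem_Icc.1 (Finset.mem_filter.1 h2).1).1; omega
    have hprod := prod_primesBelow_succ_inv_le (show 2 ≤ X by omega)
    rw [hsplit, Finset.prod_union hdisj] at hprod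
    have hπq : Real.log q ≤ ∏ ℓ ∈ q.primesBelow, (1 - 1 / (ℓ : ℝ))⁻¹ := log_le_prod_primesBelow_inv (by omega)
    have hπq0 : 0 < ∏ ℓ ∈ q.primesBelow, (1 - 1 / (ℓ : ℝ))⁻¹ := hlogq.trans_le hπq
    have hR0 : 0 ≤ ∏ ℓ ∈ (Icc q X).filter Nat.Prime, (1 - 1 / (ℓ : ℝ))⁻¹ :=
      Finset.prod_nonneg fun ℓ hℓ => by
        have hl1 : (1 : ℝ) < ℓ := by exact_mod_cast (Finset.mem_filter.1 hℓ).2.one_lt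
        have : 0 < 1 - 1 / (ℓ : ℝ) := by rw [sub_pos, div_lt_one (by linarith)]; exact hl1
        positivity
    -- log q · Π_range ≤ Π_{<q} · Π_range ≤ e⁵ log X ≤ e⁵ log(X+1)
    have h1 : Real.log q * ∏ ℓ ∈ (Icc q X).filter Nat.Prime, (1 - 1 / (ℓ : ℝ))⁻¹ ≤
        Real.exp 5 * Real.log ((X : ℝ) + 1) := by
      have hX2 : (2 : ℝ) ≤ X := by exact_mod_cast (show 2 ≤ X by omega)
      have hlogX : Real.log X ≤ Real.log ((X : ℝ) + 1) := Real.log_le_log (by linarith) (by linarith)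
      calc Real.log q * ∏ ℓ ∈ (Icc q X).filter Nat.Prime, (1 - 1 / (ℓ : ℝ))⁻¹
          ≤ (∏ ℓ ∈ q.primesBelow, (1 - 1 / (ℓ : ℝ))⁻¹) * ∏ ℓ ∈ (Icc q X).filter Nat.Prime, (1 - 1 / (ℓ : ℝ))⁻¹ :=
            mul_le_mul_of_nonneg_right hπq hR0
        _ ≤ Real.exp 5 * Real.log X := hprod
        _ ≤ Real.exp 5 * Real.log ((X : ℝ) + 1) := mul_le_mul_of_nonneg_left hlogX (Real.exp_pos 5).le
    have h2 : ∏ ℓ ∈ (Icc q X).filter Nat.Prime, (1 - 1 / (ℓ : ℝ))⁻¹ ≤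
        Real.exp 5 * Real.log ((X : ℝ) + 1) / Real.log q := by
      rw [le_div_iff₀ hlogq]; linarith
    linarith

/-! ### The fibres of `minFac` -/

/-- **The `minFac`-fibre**: for a prime `q` and every `R`,
`Σ_{2 ≤ y ≤ R, minFac y = q} 1/y ≤ (1/q)·(1 + e⁵·log(R/q + 1)/log q)`
(`y = q·m` with every prime of `m` in `[q, R/q]`; Euler product over that range). -/
theorem sum_minFac_fibre_le {q : ℕ} (hq : q.Prime) (R : ℕ) :
    ∑ y ∈ (Icc 2 R).filter (fun y => y.minFac = q), (1 : ℝ) / y ≤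
      (1 / (q : ℝ)) * (1 + Real.exp 5 * Real.log (((R / q : ℕ) : ℝ) + 1) / Real.log q) := by
  have hq0 : q ≠ 0 := hq.ne_zero
  have hq2 : 2 ≤ q := hq.two_le
  set X := R / q with hX
  set T := (Icc 1 X).filter (· ∈ Nat.factoredNumbers (Icc q X)) with hT
  -- the fibre is contained in q·T
  have hsub : (Icc 2 R).filter (fun y => y.minFac = q) ⊆ T.map ⟨fun m => q * m, mul_right_injective₀ hq0⟩ := by
    intro y hy
    obtain ⟨hyI, hmf⟩ := Finset.mem_filter.1 hy
    have hyI' := Finset.mem_Icc.1 hyI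
    have hqy : q ∣ y := hmf ▸ Nat.minFac_dvd y
    obtain ⟨m, rfl⟩ := hqy
    refine Finset.mem_map.2 ⟨m, ?_, rfl⟩
    have hm0 : m ≠ 0 := by rintro rfl; simp at hyI'
    have hmX : m ≤ X := by
      rw [hX, Nat.le_div_iff_mul_le (by omega), mul_comm]; exact hyI'.2
    refine Finset.mem_filter.2 ⟨Finset.mem_Icc.2 ⟨by omega, hmX⟩, ?_⟩
    refine Nat.mem_factoredNumbers.2 ⟨hm0, fun ℓ hℓ => ?_⟩
    have hℓ' := (Nat.mem_primeFactorsList hm0).1 hℓ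
    refine Finset.mem_Icc.2 ⟨?_, ?_⟩
    · -- ℓ ∣ q m, so q = minFac (q m) ≤ ℓ
      have : (q * m).minFac ≤ ℓ := Nat.minFac_le_of_dvd hℓ'.1.two_le (hℓ'.2.trans (dvd_mul_left m q))
      omega
    · exact (Nat.le_of_dvd (by omega) hℓ'.2).trans hmX
  calc ∑ y ∈ (Icc 2 R).filter (fun y => y.minFac = q), (1 : ℝ) / y
      ≤ ∑ y ∈ T.map ⟨fun m => q * m, mul_right_injective₀ hq0⟩, (1 : ℝ) / y :=
        Finset.sum_le_sum_of_subset_of_nonneg hsub fun y _ _ => by positivity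
    _ = ∑ m ∈ T, (1 / (q : ℝ)) * ((1 : ℝ) / m) := by
        rw [Finset.sum_map]
        refine Finset.sum_congr rfl fun m _ => ?_
        simp only [Function.Embedding.coeFn_mk]
        push_cast
        rw [one_div_mul_one_div]
    _ = (1 / (q : ℝ)) * ∑ m ∈ T, (1 : ℝ) / m := by rw [Finset.mul_sum]
    _ ≤ (1 / (q : ℝ)) * ∏ ℓ ∈ (Icc q X).filter Nat.Prime, (1 - 1 / (ℓ : ℝ))⁻¹ :=
        mul_le_mul_of_nonneg_left (sum_inv_factored_le_prod (Icc q X) X) (by positivity)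
    _ ≤ (1 / (q : ℝ)) * (1 + Real.exp 5 * Real.log ((X : ℝ) + 1) / Real.log q) :=
        mul_le_mul_of_nonneg_left (prod_range_inv_le hq2) (by positivity)

end Summit.RiemannHypothesis.RiemannHypothesis.Theorems.IntegerScrew

end
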